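import Summits.Schanuel.Schanuel.Theorems.ZilberEacRamifiedBranchAlgebraic
import Summits.Schanuel.Schanuel.Theorems.ZilberEacFibreBranchRamified
import Summits.Schanuel.Schanuel.Theorems.ZilberEacGraphUnramifiedBranch
import HarnessLib

/-!
# The equimodular class, LXIII: FIBRE CURVES WITH A RAMIFIED TOP-ROW ROOT ARE DENSE OVER POLYNOMIAL
# GRAPHS — the first theorems for top rows WITHOUT a simple nonzero root

HONEST FRAMING.  Cell `pub-schanuel` (Zilber's Exponential-Algebraic Closedness, case ladder;
host summit Schanuel), seat 2, gen 26.  Gens 24–25 decided Mantova–Masser's density question for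
fibre curves `W = {x₁ = p(x₀), Q(x₀, y₀) = 0}` over polynomial graphs (`deg p ≥ 2`) having a SIMPLE
nonzero top-row root and a zero or pole resolved by one Newton–Puiseux step.  This file removes the
simplicity of the top-row root: **along ANY analytically parametrised cycle `x₀ = s^{-k}`,
`y₀ = ψ(s)` of branches at infinity** (file LXII), non-density would make `log ψ(z^{-1/k})`
algebraic, which the transcendence theorems of gen 25 refute.  Master theorems (abstract cycle):
**`unprojectedDense_graph_cycle_unramified`** (an unramified zero `q₀(a) = 0 ≠ q₁(a)` or — `q₀ ≠ 0`
— an unramified pole `q_r(a) = 0 ≠ q_{r-1}(a)`; file XLIII) and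
**`unprojectedDense_graph_cycle_newtonBranch`** (any Newton datum of files XLIX–LI, LIV; file
XLVIII).  Corollaries for a `k`-fold top-row root `θ ≠ 0` with `T₁(θ) ≠ 0` (the `k`-cycle of file
LIII): **`unprojectedDense_graph_ramifiedTopRow_unramified`**, **`…_simpleZero`**, **`…_simplePole`**.
Example (file LXIV): `{x₁ = p(x₀), x₀y₀² + (1 - 2x₀)y₀ + x₀ = 0}`, top row `(X - 1)²` — outside
every earlier theorem.  Complete classes of instances of an OPEN question (Mantova–Masser, PLMS 2024
§1 p. 5); EC(3,2) OPEN; NOT Schanuel's conjecture (neither used nor implied; the transcendence input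
is Liouville-type differential algebra over `ℂ(z)`); EAC ⇏ SC.
-/

noncomputable section

open Filter Topology Set Complex MvPolynomial
open Literature.NumberTheory.Transcendental Literature.ModelTheory.Zilber
open Literature.ModelTheory.ExponentialFields

set_option linter.dupNamespace false

namespace Summit.Schanuel.Schanuel.Theorems

/-! ## Part A. Master theorems along an abstract cycle at infinity -/

/-- **Density along a cycle at infinity with an unramified zero or pole.**  `P` irreducible with
rows `Q` of positive `t`-degree; `x₀ = s^{-k}`, `y₀ = ψ(s)` (`k ≥ 1`, `ψ` analytic at `0`,
`ψ(0) = θ ≠ 0`) a cycle of branches of `Q = 0` at infinity; an unramified zero (`q₀(a) = 0 ≠ q₁(a)`)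
or, when `q₀ ≠ 0`, an unramified pole (`q_r(a) = 0 ≠ q_{r-1}(a)`); `deg p ≥ 2`.  Then
`{x₁ = p(x₀), P = 0}` has Zariski-dense exponential points.
[cite: MantovaMasser2023, §1 Further remarks, p. 5 (the question, open in general)] (new) -/
theorem unprojectedDense_graph_cycle_unramified (Q : Polynomial (Polynomial ℂ))
    {P : MvPolynomial (Fin 2) ℂ}
    (hP : ∀ x y : ℂ, MvPolynomial.eval ![x, y] P = (Q.map (Polynomial.evalRingHom x)).eval y)
    (hirr : Irreducible P) (hQ1 : Q.natDegree ≠ 0) {k : ℕ} (hk : 1 ≤ k)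
    {ψ : ℂ → ℂ} (hψ : AnalyticAt ℂ ψ 0) {θ : ℂ} (hθ0 : θ ≠ 0) (hψ0 : ψ 0 = θ)
    (hbranch : ∀ᶠ s in 𝓝[≠] (0 : ℂ), (Q.map (Polynomial.evalRingHom (s ^ k)⁻¹)).eval (ψ s) = 0)
    (hpt : (∃ a : ℂ, (Q.coeff 0).IsRoot a ∧ ¬ (Q.coeff 1).IsRoot a) ∨
      (Q.coeff 0 ≠ 0 ∧ ∃ a : ℂ, (Q.coeff Q.natDegree).IsRoot a ∧ ¬ (Q.coeff (Q.natDegree - 1)).IsRoot a))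
    (p : Polynomial ℂ) (hd : 2 ≤ p.natDegree) :
    UnprojectedDense {w : Fin 2 ⊕ Fin 2 → ℂ | w (Sum.inl 1) = p.eval (w (Sum.inl 0)) ∧
      MvPolynomial.eval ![w (Sum.inl 0), w (Sum.inr 0)] P = 0} := by
  by_contra hnot
  have hQirr : Irreducible Q := (irreducible_rows_iff hP).1 hirr
  obtain ⟨z₀, ρ, L, hLan, hρan, hρ0, hQρ, hL, hLalg⟩ :=
    exists_algebraic_log_of_not_dense_ramified Q hP hirr hQ1 hk hψ hθ0 hψ0 hbranch p hd hnot
  rcases hpt with ⟨a, ha, ha'⟩ | ⟨hQ00, a, ha, ha'⟩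
  · exact not_isAlgebraic_log_algebraicBranch_zero Q hQirr hQ1 ha ha' hρan hLan hρ0 hQρ hL hLalg
  · exact not_isAlgebraic_log_algebraicBranch_pole Q hQirr hQ1 hQ00 ha ha' hρan hLan hρ0 hQρ hL hLalg

/-- **Density along a cycle at infinity with a Newton-simple zero or pole.**  As
`unprojectedDense_graph_cycle_unramified`, with the finite point given by a Newton datum
`Q(a + t^e, t^μ w) = t^ν Q̃(t, w)` (or its pole form, `q₀ ≠ 0`) whose `Q̃(0, ·)` has a simple nonzero
root `w₀` (files XLIX, LI, LIV supply such data at simple zeros of `q₀`/`q_r` and along Newton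
edges). [cite: MantovaMasser2023, §1 Further remarks, p. 5 (the question, open in general)] (new) -/
theorem unprojectedDense_graph_cycle_newtonBranch (Q : Polynomial (Polynomial ℂ))
    {P : MvPolynomial (Fin 2) ℂ}
    (hP : ∀ x y : ℂ, MvPolynomial.eval ![x, y] P = (Q.map (Polynomial.evalRingHom x)).eval y)
    (hirr : Irreducible P) (hQ1 : Q.natDegree ≠ 0) {k : ℕ} (hk : 1 ≤ k)
    {ψ : ℂ → ℂ} (hψ : AnalyticAt ℂ ψ 0) {θ : ℂ} (hθ0 : θ ≠ 0) (hψ0 : ψ 0 = θ)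
    (hbranch : ∀ᶠ s in 𝓝[≠] (0 : ℂ), (Q.map (Polynomial.evalRingHom (s ^ k)⁻¹)).eval (ψ s) = 0)
    (a : ℂ) {e μ ν : ℕ} (he : 1 ≤ e) (hμ : 1 ≤ μ) (Qt : Polynomial (Polynomial ℂ)) {w₀ : ℂ}
    (hw₀ : w₀ ≠ 0) (hroot : (Qt.map (Polynomial.evalRingHom 0)).IsRoot w₀)
    (hsimple : ¬ ((Polynomial.derivative Qt).map (Polynomial.evalRingHom 0)).IsRoot w₀)
    (hid : (∀ t w : ℂ, t ≠ 0 → w ≠ 0 →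
        (Q.map (Polynomial.evalRingHom (a + t ^ e))).eval (t ^ μ * w) =
          t ^ ν * (Qt.map (Polynomial.evalRingHom t)).eval w) ∨
      (Q.coeff 0 ≠ 0 ∧ ∀ t w : ℂ, t ≠ 0 → w ≠ 0 →
        (t ^ μ * w) ^ Q.natDegree * (Q.map (Polynomial.evalRingHom (a + t ^ e))).eval (t ^ μ * w)⁻¹ =
          t ^ ν * (Qt.map (Polynomial.evalRingHom t)).eval w))
    (p : Polynomial ℂ) (hd : 2 ≤ p.natDegree) :
    UnprojectedDense {w : Fin 2 ⊕ Fin 2 → ℂ | w (Sum.inl 1) = p.eval (w (Sum.inl 0)) ∧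
      MvPolynomial.eval ![w (Sum.inl 0), w (Sum.inr 0)] P = 0} := by
  by_contra hnot
  have hQirr : Irreducible Q := (irreducible_rows_iff hP).1 hirr
  obtain ⟨z₀, ρ, L, hLan, hρan, hρ0, hQρ, hL, hLalg⟩ :=
    exists_algebraic_log_of_not_dense_ramified Q hP hirr hQ1 hk hψ hθ0 hψ0 hbranch p hd hnot
  have hγan : AnalyticAt ℂ (fun t : ℂ => a + t ^ e) 0 := analyticAt_const.add (analyticAt_id.pow e)
  have hγ' := deriv_newtonBase_ne_zero a he
  rcases hid with hid | ⟨hQ00, hid⟩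
  · obtain ⟨η, hηan, hη0, hηne, hQη⟩ := exists_newtonBranch Q Qt a hμ hid hw₀ hroot hsimple
    exact not_isAlgebraic_log_algebraicBranch_param Q hQirr hQ1 hγan hηan hη0 hγ' hηne hQη hρan hLan
      hρ0 hQρ hL hLalg
  · obtain ⟨η, hηan, hη0, hηne, hQη⟩ := exists_newtonBranch_pole Q Qt a hμ hid hw₀ hroot hsimple
    exact not_isAlgebraic_log_algebraicBranch_param_pole Q hQirr hQ1 hQ00 hγan hηan hη0 hγ' hηne hQη hρan
      hLan hρ0 hQρ hL hLalg

/-! ## Part B. A `k`-fold top-row root `θ ≠ 0` with `T₁(θ) ≠ 0` -/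

/-- **Fibre curves with a RAMIFIED top-row root and an unramified zero or pole are dense over
polynomial graphs of degree `≥ 2`.**  Rows of degree `≤ N` (`N ≥ 1`), top row `T ≠ 0`, next row `T₁`;
`θ ≠ 0` a root of `T` of ANY multiplicity with `T₁(θ) ≠ 0`; an unramified zero or (`q₀ ≠ 0`) pole.
[cite: MantovaMasser2023, §1 Further remarks, p. 5 (the question, open in general)] (new) -/
theorem unprojectedDense_graph_ramifiedTopRow_unramified (Q : Polynomial (Polynomial ℂ))
    {P : MvPolynomial (Fin 2) ℂ}
    (hP : ∀ x y : ℂ, MvPolynomial.eval ![x, y] P = (Q.map (Polynomial.evalRingHom x)).eval y)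
    (hirr : Irreducible P) (N : ℕ) (hN1 : 1 ≤ N) (hN : ∀ j, (Q.coeff j).natDegree ≤ N)
    (T T₁ : Polynomial ℂ) (hT : ∀ j, T.coeff j = (Q.coeff j).coeff N)
    (hT₁ : ∀ j, T₁.coeff j = (Q.coeff j).coeff (N - 1)) (hT0 : T ≠ 0) {θ : ℂ} (hθ0 : θ ≠ 0)
    (hTθ : T.IsRoot θ) (hT₁θ : ¬ T₁.IsRoot θ)
    (hpt : (∃ a : ℂ, (Q.coeff 0).IsRoot a ∧ ¬ (Q.coeff 1).IsRoot a) ∨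
      (Q.coeff 0 ≠ 0 ∧ ∃ a : ℂ, (Q.coeff Q.natDegree).IsRoot a ∧ ¬ (Q.coeff (Q.natDegree - 1)).IsRoot a))
    (p : Polynomial ℂ) (hd : 2 ≤ p.natDegree) :
    UnprojectedDense {w : Fin 2 ⊕ Fin 2 → ℂ | w (Sum.inl 1) = p.eval (w (Sum.inl 0)) ∧
      MvPolynomial.eval ![w (Sum.inl 0), w (Sum.inr 0)] P = 0} := by
  have hQ1 : Q.natDegree ≠ 0 := fun h =>
    natDegree_ne_zero_of_isRoot hT0 hTθ (Nat.le_zero.1 (h ▸ natDegree_topRow_le Q N T hT))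
  obtain ⟨k, ψ, hk, -, hψ, hψ0, -, hbranch⟩ := exists_fibreBranch_ramified Q N hN1 hN T T₁ hT hT₁ hT0 hTθ hT₁θ
  exact unprojectedDense_graph_cycle_unramified Q hP hirr hQ1 hk hψ hθ0 hψ0 hbranch hpt p hd

/-- **A ramified top-row root and a simple root of `q₀` suffice** (the `(1, k)` Newton datum of
file LI). [cite: MantovaMasser2023, §1 Further remarks, p. 5 (the question, open in general)] (new) -/
theorem unprojectedDense_graph_ramifiedTopRow_simpleZero (Q : Polynomial (Polynomial ℂ))
    {P : MvPolynomial (Fin 2) ℂ}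
    (hP : ∀ x y : ℂ, MvPolynomial.eval ![x, y] P = (Q.map (Polynomial.evalRingHom x)).eval y)
    (hirr : Irreducible P) (N : ℕ) (hN1 : 1 ≤ N) (hN : ∀ j, (Q.coeff j).natDegree ≤ N)
    (T T₁ : Polynomial ℂ) (hT : ∀ j, T.coeff j = (Q.coeff j).coeff N)
    (hT₁ : ∀ j, T₁.coeff j = (Q.coeff j).coeff (N - 1)) (hT0 : T ≠ 0) {θ : ℂ} (hθ0 : θ ≠ 0)
    (hTθ : T.IsRoot θ) (hT₁θ : ¬ T₁.IsRoot θ)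
    {a : ℂ} (ha : (Q.coeff 0).IsRoot a) (ha' : ¬ (Polynomial.derivative (Q.coeff 0)).IsRoot a)
    (p : Polynomial ℂ) (hd : 2 ≤ p.natDegree) :
    UnprojectedDense {w : Fin 2 ⊕ Fin 2 → ℂ | w (Sum.inl 1) = p.eval (w (Sum.inl 0)) ∧
      MvPolynomial.eval ![w (Sum.inl 0), w (Sum.inr 0)] P = 0} := by
  have hQirr : Irreducible Q := (irreducible_rows_iff hP).1 hirr
  have hQ1 : Q.natDegree ≠ 0 := fun h =>
    natDegree_ne_zero_of_isRoot hT0 hTθ (Nat.le_zero.1 (h ▸ natDegree_topRow_le Q N T hT))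
  obtain ⟨k, ψ, hk, -, hψ, hψ0, -, hbranch⟩ := exists_fibreBranch_ramified Q N hN1 hN T T₁ hT hT₁ hT0 hTθ hT₁θ
  obtain ⟨e, Qt, w₀, he1, hw₀, hroot, hsimple, hid, -, -⟩ :=
    exists_newtonDatum_simpleZero Q (exists_coeff_not_isRoot_of_irreducible hQirr hQ1 a) ha ha'
  exact unprojectedDense_graph_cycle_newtonBranch Q hP hirr hQ1 hk hψ hθ0 hψ0 hbranch a (ν := e) he1 le_rfl
    Qt hw₀ hroot hsimple (Or.inl hid) p hd

/-- **A ramified top-row root and a simple root of `q_r` suffice** (`q₀ ≠ 0`; pole form).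
[cite: MantovaMasser2023, §1 Further remarks, p. 5 (the question, open in general)] (new) -/
theorem unprojectedDense_graph_ramifiedTopRow_simplePole (Q : Polynomial (Polynomial ℂ))
    {P : MvPolynomial (Fin 2) ℂ}
    (hP : ∀ x y : ℂ, MvPolynomial.eval ![x, y] P = (Q.map (Polynomial.evalRingHom x)).eval y)
    (hirr : Irreducible P) (N : ℕ) (hN1 : 1 ≤ N) (hN : ∀ j, (Q.coeff j).natDegree ≤ N)
    (T T₁ : Polynomial ℂ) (hT : ∀ j, T.coeff j = (Q.coeff j).coeff N)
    (hT₁ : ∀ j, T₁.coeff j = (Q.coeff j).coeff (N - 1)) (hT0 : T ≠ 0) {θ : ℂ} (hθ0 : θ ≠ 0)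
    (hTθ : T.IsRoot θ) (hT₁θ : ¬ T₁.IsRoot θ) (hQ00 : Q.coeff 0 ≠ 0)
    {a : ℂ} (ha : (Q.coeff Q.natDegree).IsRoot a)
    (ha' : ¬ (Polynomial.derivative (Q.coeff Q.natDegree)).IsRoot a)
    (p : Polynomial ℂ) (hd : 2 ≤ p.natDegree) :
    UnprojectedDense {w : Fin 2 ⊕ Fin 2 → ℂ | w (Sum.inl 1) = p.eval (w (Sum.inl 0)) ∧
      MvPolynomial.eval ![w (Sum.inl 0), w (Sum.inr 0)] P = 0} := by
  classical
  have hQirr : Irreducible Q := (irreducible_rows_iff hP).1 hirr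
  have hQ1 : Q.natDegree ≠ 0 := fun h =>
    natDegree_ne_zero_of_isRoot hT0 hTθ (Nat.le_zero.1 (h ▸ natDegree_topRow_le Q N T hT))
  obtain ⟨k, ψ, hk, -, hψ, hψ0, -, hbranch⟩ := exists_fibreBranch_ramified Q N hN1 hN T T₁ hT hT₁ hT0 hTθ hT₁θ
  have hN' : Q.reverse.natDegree = Q.natDegree := by
    rw [Polynomial.reverse_natDegree, Polynomial.natTrailingDegree_eq_zero_of_constantCoeff_ne_zero hQ00,
      Nat.sub_zero]
  have hirr' : Irreducible Q.reverse := irreducible_reverse hQirr hQ00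
  have h0' : (Q.reverse.coeff 0).IsRoot a := by rw [Polynomial.coeff_zero_reverse]; exact ha
  have h0'' : ¬ (Polynomial.derivative (Q.reverse.coeff 0)).IsRoot a := by
    rw [Polynomial.coeff_zero_reverse]; exact ha'
  obtain ⟨e, Qt, w₀, he1, hw₀, hroot, hsimple, hid, -, -⟩ :=
    exists_newtonDatum_simpleZero Q.reverse
      (exists_coeff_not_isRoot_of_irreducible hirr' (by rw [hN']; exact hQ1) a) h0' h0''
  refine unprojectedDense_graph_cycle_newtonBranch Q hP hirr hQ1 hk hψ hθ0 hψ0 hbranch a (ν := e) he1 le_rfl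
    Qt hw₀ hroot hsimple (Or.inr ⟨hQ00, fun t w ht hw => ?_⟩) p hd
  -- the pole identity from the reversed one
  have hx0 : t ^ 1 * w ≠ 0 := mul_ne_zero (pow_ne_zero _ ht) hw
  haveI := invertibleOfNonzero (inv_ne_zero hx0)
  have h := Polynomial.eval₂_reverse_mul_pow (Polynomial.evalRingHom (a + t ^ e)) (t ^ 1 * w)⁻¹ Q
  rw [invOf_eq_inv, inv_inv] at h
  have hid1 := hid t w ht hw
  rw [Polynomial.eval_map] at hid1
  rw [Polynomial.eval_map, ← hid1, ← h, inv_pow]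
  field_simp

end Summit.Schanuel.Schanuel.Theorems
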